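import Summits.ValiantsHypothesis.ValiantsHypothesis.Theorems.GrenetZeonDualUnipotentThreeHalvesLongMassHomogenise
import Summits.ValiantsHypothesis.ValiantsHypothesis.Theorems.GrenetZeonDualUnipotentThreeHalvesLongMassLedgerIndexShadowSpace

/-!
# `GrenetZeon.DualUnipotentThreeHalves` (stmt-ValiantsHypothesis-24318), line `slow_core`, stub (c) `SlowCore.LongMassSlowLawInv`:
# THE (c)-PRICE OF A LINEAR PENCIL IS AN INVARIANT OF ITS VALUE SPACE

Sequel of ✓ `…LongMassHomogenise` (the constant part is free in (c): `longMassSlowLawInv_iff_linear`).  For a LINEAR pencil `N : AffMat n b`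
(affine, constant part `0`) write `lin_N v := linMat N v ∈ M_b(ℂ)` (✓ `ResolventFlag.linMat`) and call `W̄(N) := {lin_N v}` its VALUE SPACE.
THEOREM ★★ `relCert_of_valueSpace` / ★★★ `relCert_iff_of_valueSpace_eq`: two linear pencils over the SAME `n²` coordinates with the SAME value
space (`∀ v ∃ v₁, lin_N v = lin_{N₁} v₁` and conversely — no relation between the parametrisations is assumed, masses may be reached on different
coordinates, coefficient matrices may be dependent) have the SAME certificates prices: `RelCert n b N P ↔ RelCert n b N₁ P` for every `P`.

So, BY NAME, the registered research statement (c) (≡ `LongMassSlowLawAll` ≡ its linear form) is a statement about NILPOTENT MATRIX SUBSPACES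
`W̄ ≤ M_b(ℂ)` of dimension `≤ n²` together with the window parameter `n` — the currency in which the cell's census and crit-7's enemy spec (V34
§2, «W̄») are written; re-parametrisations of a value space (duplicating, mixing or permuting coordinates) never change the price.

Proof.  Let `T, T₁` be the linear maps `v ↦ lin v` (✓ `LedgerIndex.exists_linearMap_linMat`); the hypotheses say `range T = range T₁`.  Given a
certificate `(K₁, k)` of `N₁`, put `K := T⁻¹(T₁ K₁)`.  LEDGER: for `x, v` with `v ∈ K` pick `x₁, v₁ ∈ K₁` with `lin_N x = lin_{N₁} x₁`, `lin_N v =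
lin_{N₁} v₁`; a linear pencil's line is `N(x + s v) = lin x + s·lin v` (`map_lineSubst_eq_of_linMat_eq`), so the two pulled-back lines coincide and
the window degrees agree.  PRICE: `dim K = dim (T₁K₁) + dim ker T` (`ker T ≤ K`, `T K = T₁ K₁`) and `dim (T₁ K₁) ≥ dim range T₁ − codim K₁`
(✓ `LedgerIndex.codim_map_le_codim`), `dim ker T = n² − dim range T`, `range T = range T₁` ⇒ `codim K ≤ codim K₁` (`codim_comap_map_le`).

Honest framing.  A REFORMULATION / invariance lemma (`--supports stmt-ValiantsHypothesis-24318`), NOT progress on (c): (c)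
`SlowCore.LongMassSlowLawInv`, S3, the crux 24318, 8062 and `VP ≠ VNP` remain OPEN / NOT proved.  No sorry, no definitions, no named facts.
-/

-- single-conjunct layout: Sub = Summit, duplicated namespace component intended (the name is mandated)
set_option linter.dupNamespace false
set_option autoImplicit false

noncomputable section

namespace Summit.ValiantsHypothesis.ValiantsHypothesis.Theorems.GrenetZeon.LongMassHomogenise

open MvPolynomial Matrix
open scoped BigOperators
open Summit.ValiantsHypothesis.ValiantsHypothesis.Cruxes.TwoDimCoefficients.DimTwoCases (AffMat IsAffine)
open Summit.ValiantsHypothesis.ValiantsHypothesis.Theorems.GrenetZeon.RadicalSplit (lineSubst)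
open Summit.ValiantsHypothesis.ValiantsHypothesis.Theorems.GrenetZeon.SlowCore
open Summit.ValiantsHypothesis.ValiantsHypothesis.Theorems.GrenetZeon.ResolventFlag (linMat)
open Summit.ValiantsHypothesis.ValiantsHypothesis.Theorems.GrenetZeon.LedgerIndex (exists_linearMap_linMat codim_map_le_codim)

variable {n b : ℕ}

/-! ## §1 The line of a LINEAR pencil is read off its value space -/

/-- For a LINEAR pencil (affine, constant part `0`) the value at `x` is the linear part: `N_ij(x) = linEntry N i j x`. -/
theorem eval_eq_linEntry_of_linear (N : AffMat n b) (hN : IsAffine N) (h0 : ∀ i j, coeff 0 (N i j) = 0)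
    (x : Fin n × Fin n → ℂ) (i j : Fin b) : eval x (N i j) = linEntry N i j x := by
  rw [eval_eq_of_totalDegree_le_one _ (hN i j), h0, zero_add, linEntry]
  exact Finset.sum_congr rfl fun e _ => mul_comm _ _

/-- ★ The pulled-back line of a LINEAR pencil depends only on the two values `lin x`, `lin v`: if `lin_N x = lin_{N₁} x₁` and
`lin_N v = lin_{N₁} v₁` then `N(x + s v) = N₁(x₁ + s v₁)` as polynomial matrices in `s`. -/
theorem map_lineSubst_eq_of_linMat_eq (N N₁ : AffMat n b) (hN : IsAffine N) (hN₁ : IsAffine N₁)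
    (h0 : ∀ i j, coeff 0 (N i j) = 0) (h0₁ : ∀ i j, coeff 0 (N₁ i j) = 0)
    {x v x₁ v₁ : Fin n × Fin n → ℂ} (hx : linMat N x = linMat N₁ x₁) (hv : linMat N v = linMat N₁ v₁) :
    N.map (lineSubst x v) = N₁.map (lineSubst x₁ v₁) := by
  ext i j : 2
  simp only [Matrix.map_apply]
  have hx' : linEntry N i j x = linEntry N₁ i j x₁ := by
    have := congr_fun (congr_fun hx i) j
    simpa [linMat] using this
  have hv' : linEntry N i j v = linEntry N₁ i j v₁ := by
    have := congr_fun (congr_fun hv i) j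
    simpa [linMat] using this
  rw [lineSubst_apply_of_le_one N hN, lineSubst_apply_of_le_one N₁ hN₁, eval_eq_linEntry_of_linear N hN h0,
    eval_eq_linEntry_of_linear N₁ hN₁ h0₁, hx', hv']

/-! ## §2 Dimension bookkeeping: pulling `T₁ K₁` back along `T` does not raise the codimension -/

/-- If `range T = range T₁` then `codim T⁻¹(T₁ K₁) ≤ codim K₁`. -/
theorem codim_comap_map_le (T T₁ : (Fin n × Fin n → ℂ) →ₗ[ℂ] Matrix (Fin b) (Fin b) ℂ)
    (hrange : LinearMap.range T = LinearMap.range T₁) (K₁ : Submodule ℂ (Fin n × Fin n → ℂ)) :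
    n * n - Module.finrank ℂ ((K₁.map T₁).comap T) ≤ n * n - Module.finrank ℂ K₁ := by
  set W := K₁.map T₁ with hW
  set K := W.comap T with hK
  have hV : Module.finrank ℂ (Fin n × Fin n → ℂ) = n * n := by
    rw [Module.finrank_pi, Fintype.card_prod, Fintype.card_fin]
  -- `W ≤ range T`
  have hWle : W ≤ LinearMap.range T := by
    rw [hrange, hW]; exact LinearMap.map_le_range
  -- `T K = W`
  have hmap : K.map T = W := by
    rw [hK, Submodule.map_comap_eq]; exact inf_eq_right.mpr hWle
  -- rank–nullity for `T ∘ K.subtype`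
  have h2 := LinearMap.finrank_range_add_finrank_ker (T ∘ₗ K.subtype)
  have hrangeK : LinearMap.range (T ∘ₗ K.subtype) = K.map T := by
    rw [LinearMap.range_comp, Submodule.range_subtype]
  have hkerle : LinearMap.ker T ≤ K := by
    intro z hz
    rw [hK, Submodule.mem_comap, LinearMap.mem_ker.mp hz]
    exact W.zero_mem
  have hkerK : Module.finrank ℂ (LinearMap.ker (T ∘ₗ K.subtype)) = Module.finrank ℂ (LinearMap.ker T) := by
    rw [LinearMap.ker_comp]
    exact (Submodule.comapSubtypeEquivOfLe hkerle).finrank_eq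
  rw [hrangeK, hmap, hkerK, Module.finrank_eq_card_basis (Module.finBasis ℂ K)] at h2
  -- rank–nullity for `T`, the shadow inequality for `T₁`
  have h1 := LinearMap.finrank_range_add_finrank_ker T
  rw [hV] at h1
  have h3 := codim_map_le_codim T₁ K₁
  rw [← hrange, ← hW] at h3
  have hK₁ : Module.finrank ℂ K₁ ≤ n * n := hV ▸ Submodule.finrank_le K₁
  have hWr : Module.finrank ℂ W ≤ Module.finrank ℂ (LinearMap.range T) := Submodule.finrank_mono hWle
  have hcard : Fintype.card (Fin (Module.finrank ℂ K)) = Module.finrank ℂ K := Fintype.card_fin _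
  rw [hcard] at h2
  omega

/-! ## §3 The price is an invariant of the value space -/

/-- ★★ **VALUE-SPACE TRANSFER.**  If the value space of the linear pencil `N` is contained in that of the linear pencil `N₁` and conversely, then
every certificate price of `N₁` is a certificate price of `N`. -/
theorem relCert_of_valueSpace (N N₁ : AffMat n b) (hN : IsAffine N) (hN₁ : IsAffine N₁)
    (h0 : ∀ i j, coeff 0 (N i j) = 0) (h0₁ : ∀ i j, coeff 0 (N₁ i j) = 0)
    (hle : ∀ v, ∃ v₁, linMat N v = linMat N₁ v₁) (hge : ∀ v₁, ∃ v, linMat N₁ v₁ = linMat N v)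
    {P : ℕ} (h : RelCert n b N₁ P) : RelCert n b N P := by
  obtain ⟨T, hT⟩ := exists_linearMap_linMat N
  obtain ⟨T₁, hT₁⟩ := exists_linearMap_linMat N₁
  have hrange : LinearMap.range T = LinearMap.range T₁ := by
    apply le_antisymm
    · rintro _ ⟨v, rfl⟩
      obtain ⟨v₁, hv₁⟩ := hle v
      exact ⟨v₁, by rw [hT₁, ← hv₁, hT]⟩
    · rintro _ ⟨v₁, rfl⟩
      obtain ⟨v, hv⟩ := hge v₁
      exact ⟨v, by rw [hT, ← hv, hT₁]⟩
  obtain ⟨K₁, k, hK₁, hprice⟩ := h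
  refine ⟨(K₁.map T₁).comap T, k, ?_, ?_⟩
  · intro x v hv p hp i j _ _
    obtain ⟨x₁, hx₁⟩ := hle x
    obtain ⟨v₁, hv₁K, hv₁⟩ := Submodule.mem_map.mp (Submodule.mem_comap.mp hv)
    have hv' : linMat N v = linMat N₁ v₁ := by rw [← hT, ← hT₁, hv₁]
    rw [map_lineSubst_eq_of_linMat_eq N N₁ hN hN₁ h0 h0₁ hx₁ hv']
    exact hK₁ x₁ v₁ hv₁K p hp i j trivial trivial
  · exact le_trans (Nat.add_le_add_left (codim_comap_map_le T T₁ hrange K₁) _) hprice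

/-- ★★★ **THE (c)-PRICE IS AN INVARIANT OF THE VALUE SPACE**: two linear pencils over the `n²` coordinates with the same value space have the
same certificate prices. -/
theorem relCert_iff_of_valueSpace_eq (N N₁ : AffMat n b) (hN : IsAffine N) (hN₁ : IsAffine N₁)
    (h0 : ∀ i j, coeff 0 (N i j) = 0) (h0₁ : ∀ i j, coeff 0 (N₁ i j) = 0)
    (hle : ∀ v, ∃ v₁, linMat N v = linMat N₁ v₁) (hge : ∀ v₁, ∃ v, linMat N₁ v₁ = linMat N v) (P : ℕ) :
    RelCert n b N P ↔ RelCert n b N₁ P :=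
  ⟨fun h => relCert_of_valueSpace N₁ N hN₁ hN h0₁ h0 hge hle h,
   fun h => relCert_of_valueSpace N N₁ hN hN₁ h0 h0₁ hle hge h⟩

end Summit.ValiantsHypothesis.ValiantsHypothesis.Theorems.GrenetZeon.LongMassHomogenise

end
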